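import Mathlib.MeasureTheory.Integral.DivergenceTheorem
import Mathlib.MeasureTheory.Measure.Haar.InnerProductSpace
import Literature.Analysis.PDE.NeumannHalfBallRegularity
import HarnessLib

/-!
# The divergence theorem on a half-ball for fields supported in the ball, and the pointwise
# conormal boundary condition of weak Neumann solutions

Topic `Analysis/PDE`. Theorem file (no definitions, no named facts; everything proved), on the
discharge path of `Literature.Geometry.Riemannian.sharpLogSobolevAVR_four`.

* `setIntegral_divergence_halfBall` (**divergence theorem on a half-ball**): for a `C¹` vector field
  `X` on an `(n+1)`-dimensional inner product space `H` with `tsupport X ⊆ B(z,R)` and an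
  orthonormal basis `b` (indexed by `Fin (n+1)`) with `b 0 = ν/‖ν‖`,
  `∫_{U_R} div X = ∫_{flat face} ⟪X, b 0⟫`, `U_R = B(z,R) ∩ {⟪y - z, ν⟫ < 0}` (Mathlib's divergence
  theorem on the box `[⟪b i,z⟫ - R, ⟪b i,z⟫ + R]^{n} × [⟪b 0,z⟫ - R, ⟪b 0, z⟫]` in the coordinates
  of `b`, all faces but the top one carrying no mass).
* `integral_divergence_eq_zero_of_tsupport_subset_ball` : `∫ div X = 0` for such fields
  (a half-ball containing the support away from its flat face).
* `divergence_eq_neg_of_weak` (**the equation holds pointwise**): if `Y ∈ C¹`, `F` is continuous on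
  an open `U` and `∫_U ∂ζ(Y) = ∫_U F ζ` for all `ζ ∈ C_c^∞(U)`, then `div Y = -F` on `U`.
* `inner_eq_zero_of_weak_halfBall` (**the conormal boundary condition holds pointwise**, Evans,
  *PDE*, §6.3.2 / Taylor, *PDE I*, Ch. 5 §7, (7.13)–(7.14): "a sufficiently smooth weak solution of
  the Neumann problem satisfies the boundary condition"): if moreover `U = U_R` and the identity
  holds for all `ζ ∈ C_c^∞(B(z,R))` (free on the flat part), then `⟪Y, ν⟫ = 0` on the flat part
  `B(z,R) ∩ {⟪y - z, ν⟫ = 0}`.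

## References

* L. C. Evans, *Partial Differential Equations*, 2nd ed. (2010), §6.3.2, App. C.2. [Evans2010]
* M. E. Taylor, *Partial Differential Equations I*, 2nd ed. (2011), Ch. 5 §7. [TaylorPDEI2011]
-/

noncomputable section

open MeasureTheory TopologicalSpace Set Function Filter Topology InnerProductSpace Metric
open scoped RealInnerProductSpace ENNReal NNReal ContDiff

namespace Literature.Analysis.PDE

variable {H : Type*} [NormedAddCommGroup H] [InnerProductSpace ℝ H] [FiniteDimensional ℝ H]
  [MeasurableSpace H] [BorelSpace H] {n : ℕ}

/-- The hyperplane `{⟪y - z, ν⟫ = 0}` is Lebesgue-null. [folklore] -/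
theorem volume_hyperplane_eq_zero {ν : H} (hν : ν ≠ 0) (z : H) :
    volume {y : H | ⟪y - z, ν⟫ = 0} = 0 := by
  let S : AffineSubspace ℝ H :=
    AffineSubspace.mk' z (LinearMap.ker ((innerSL ℝ ν : H →L[ℝ] ℝ) : H →ₗ[ℝ] ℝ))
  have hS : (S : Set H) = {y : H | ⟪y - z, ν⟫ = 0} := by
    ext y
    simp only [S, SetLike.mem_coe, AffineSubspace.mem_mk', vsub_eq_sub,
      LinearMap.mem_ker, ContinuousLinearMap.coe_coe, innerSL_apply_apply, mem_setOf_eq]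
    rw [real_inner_comm]
  have hSne : S ≠ ⊤ := by
    intro h
    have : z + ν ∈ (S : Set H) := by rw [h]; trivial
    rw [hS, mem_setOf_eq, add_sub_cancel_left, real_inner_self_eq_norm_sq] at this
    exact hν (norm_eq_zero.1 (pow_eq_zero_iff two_ne_zero |>.1 this))
  rw [← hS]
  exact Measure.addHaar_affineSubspace volume S hSne

set_option maxHeartbeats 1600000 in
/-- **The divergence theorem on a half-ball** for `C¹` fields supported in the open ball: the only
boundary contribution is the flat face. [cite: Evans2010, App. C.2 Theorem 1 (Gauss–Green)] -/
theorem setIntegral_divergence_halfBall (b : OrthonormalBasis (Fin (n + 1)) ℝ H) {ν z : H}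
    (hν : ν ≠ 0) (hb0 : b 0 = ‖ν‖⁻¹ • ν) {R : ℝ} (hR : 0 < R) {X : H → H} (hX : ContDiff ℝ 1 X)
    (hXs : tsupport X ⊆ ball z R) :
    ∫ y in (halfBall ν z R : Set H), ∑ i, ⟪fderiv ℝ X y (b i), b i⟫ =
      ∫ x in Icc ((fun i ↦ ⟪b i, z⟫ - R) ∘ Fin.succAbove 0)
          ((fun i ↦ if i = 0 then ⟪b 0, z⟫ else ⟪b i, z⟫ + R) ∘ Fin.succAbove 0),
        ⟪X (b.repr.symm (WithLp.toLp 2 (Fin.insertNth (0 : Fin (n + 1)) ⟪b 0, z⟫ x))), b 0⟫ := by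
  -- coordinates
  set T : H → (Fin (n + 1) → ℝ) := fun y ↦ WithLp.ofLp (b.repr y) with hT
  set Ti : (Fin (n + 1) → ℝ) → H := fun p ↦ b.repr.symm (WithLp.toLp 2 p) with hTi
  have hTi_T : ∀ y, Ti (T y) = y := fun y ↦ by simp [hT, hTi]
  have hT_Ti : ∀ p, T (Ti p) = p := fun p ↦ by simp [hT, hTi]
  have hT_apply : ∀ y i, T y i = ⟪b i, y⟫ := fun y i ↦ by
    simp [hT, OrthonormalBasis.repr_apply_apply]
  set TiL : (Fin (n + 1) → ℝ) →L[ℝ] H :=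
    (b.repr.symm.toContinuousLinearEquiv : EuclideanSpace ℝ (Fin (n + 1)) →L[ℝ] H).comp
      ((EuclideanSpace.equiv (Fin (n + 1)) ℝ).symm : (Fin (n + 1) → ℝ) →L[ℝ] _) with hTiL
  have hTiL_apply : ∀ p, TiL p = Ti p := fun p ↦ rfl
  have hTi_single : ∀ i, Ti (Pi.single i 1) = b i := fun i ↦ by
    rw [hTi]; show b.repr.symm (WithLp.toLp 2 (Pi.single i 1)) = b i
    rw [PiLp.toLp_single]; exact b.repr_symm_single i
  have hmp : MeasurePreserving T volume volume :=
    (PiLp.volume_preserving_ofLp (Fin (n + 1))).comp b.measurePreserving_repr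
  have hme : MeasurableEmbedding T := by
    have : MeasurableEmbedding
        (b.measurableEquiv.trans (MeasurableEquiv.toLp 2 (Fin (n + 1) → ℝ)).symm) :=
      MeasurableEquiv.measurableEmbedding _
    exact this
  -- unit normal
  have hνn : 0 < ‖ν‖ := norm_pos_iff.2 hν
  have hb0_inner : ∀ y : H, ⟪b 0, y⟫ = ‖ν‖⁻¹ * ⟪ν, y⟫ := fun y ↦ by
    rw [hb0, real_inner_smul_left]
  -- the box
  set lo : Fin (n + 1) → ℝ := fun i ↦ ⟪b i, z⟫ - R with hlo
  set hi : Fin (n + 1) → ℝ := fun i ↦ if i = 0 then ⟪b 0, z⟫ else ⟪b i, z⟫ + R with hhi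
  have hle : lo ≤ hi := fun i ↦ by
    simp only [hlo, hhi]
    split_ifs with h
    · subst h; linarith
    · linarith
  -- coordinates of points of the ball lie strictly inside
  have hcoord : ∀ y ∈ ball z R, ∀ i, |⟪b i, y⟫ - ⟪b i, z⟫| < R := fun y hy i ↦ by
    rw [← inner_sub_right]
    refine lt_of_le_of_lt (abs_real_inner_le_norm _ _) ?_
    rw [b.orthonormal.1 i, one_mul, ← dist_eq_norm]; exact hy
  -- the components and their derivatives
  set f : Fin (n + 1) → (Fin (n + 1) → ℝ) → ℝ := fun i p ↦ ⟪X (Ti p), b i⟫ with hf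
  set f' : Fin (n + 1) → (Fin (n + 1) → ℝ) → (Fin (n + 1) → ℝ) →L[ℝ] ℝ := fun i p ↦
    ((innerSL ℝ (b i)).comp (fderiv ℝ X (Ti p))).comp TiL with hf'
  have hXd : ∀ y, HasFDerivAt X (fderiv ℝ X y) y := fun y ↦
    (hX.differentiable one_ne_zero y).hasFDerivAt
  have hTiL_coe : (TiL : (Fin (n + 1) → ℝ) → H) = Ti := funext fun p ↦ hTiL_apply p
  have hTid : ∀ p, HasFDerivAt Ti TiL p := fun p ↦ by
    have := TiL.hasFDerivAt (x := p)
    rwa [hTiL_coe] at this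
  have Hd : ∀ p i, HasFDerivAt (f i) (f' i p) p := fun p i ↦ by
    have h1 : HasFDerivAt (fun q ↦ X (Ti q)) ((fderiv ℝ X (Ti p)).comp TiL) p :=
      (hXd (Ti p)).comp p (hTid p)
    have h2 := (innerSL ℝ (b i)).hasFDerivAt.comp p h1
    have e : ((innerSL ℝ (b i)) ∘ fun q ↦ X (Ti q)) = f i := funext fun q ↦ by
      simp only [hf, Function.comp_apply, innerSL_apply_apply, real_inner_comm]
    rw [e] at h2
    exact h2
  have hTic : Continuous Ti := TiL.continuous.congr fun p ↦ hTiL_apply p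
  have Hc : ∀ i, ContinuousOn (f i) (Icc lo hi) := fun i ↦
    ((hX.continuous.comp hTic).inner continuous_const).continuousOn
  have hdivc : Continuous fun y : H ↦ ∑ i, ⟪fderiv ℝ X y (b i), b i⟫ :=
    continuous_finsetSum _ fun i _ ↦
      (((hX.continuous_fderiv one_ne_zero).clm_apply continuous_const).inner continuous_const)
  have hsum : ∀ p, ∑ i, f' i p (Pi.single i 1) = ∑ i, ⟪fderiv ℝ X (Ti p) (b i), b i⟫ := fun p ↦ by
    refine Finset.sum_congr rfl fun i _ ↦ ?_
    simp only [hf', ContinuousLinearMap.comp_apply, innerSL_apply_apply, hTiL_apply, hTi_single,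
      real_inner_comm]
  have Hi : IntegrableOn (fun p ↦ ∑ i, f' i p (Pi.single i 1)) (Icc lo hi) := by
    have hc : Continuous fun p ↦ ∑ i, f' i p (Pi.single i 1) := by
      simp_rw [hsum]; exact hdivc.comp hTic
    exact hc.continuousOn.integrableOn_compact isCompact_Icc
  have key := integral_divergence_of_hasFDerivAt_off_countable' lo hi hle f f' ∅ countable_empty Hc
    (fun p _ i ↦ Hd p i) Hi
  -- the left-hand side is the integral over the half-ball
  have hXzero : ∀ y, y ∉ ball z R → X y = 0 := fun y hy ↦
    image_eq_zero_of_notMem_tsupport fun h ↦ hy (hXs h)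
  have hdiv_zero : ∀ y, y ∉ ball z R → ∑ i, ⟪fderiv ℝ X y (b i), b i⟫ = 0 := fun y hy ↦ by
    have : fderiv ℝ X y = 0 :=
      image_eq_zero_of_notMem_tsupport fun h ↦ hy (hXs (tsupport_fderiv_subset ℝ h))
    simp [this]
  have hLHS : ∫ p in Icc lo hi, ∑ i, f' i p (Pi.single i 1) =
      ∫ y in (halfBall ν z R : Set H), ∑ i, ⟪fderiv ℝ X y (b i), b i⟫ := by
    simp_rw [hsum]
    have h1 := hmp.setIntegral_preimage_emb hme
      (fun p ↦ ∑ i, ⟪fderiv ℝ X (Ti p) (b i), b i⟫) (Icc lo hi)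
    simp only [hTi_T] at h1
    rw [← h1]
    -- `U_R ⊆ T ⁻¹' box`, and the integrand vanishes a.e. on the difference
    refine setIntegral_eq_of_subset_of_ae_sdiff_eq_zero
      (hme.measurable measurableSet_Icc).nullMeasurableSet ?_ ?_
    · intro y hy
      rw [mem_halfBall] at hy
      rw [mem_preimage, mem_Icc]
      have hc := hcoord y hy.1
      refine ⟨fun i ↦ ?_, fun i ↦ ?_⟩
      · simp only [hlo, hT_apply]
        have := hc i; rw [abs_lt] at this; linarith
      · simp only [hhi, hT_apply]
        split_ifs with h
        · subst h
          rw [hb0_inner, hb0_inner]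
          have h2 : ⟪ν, y⟫ - ⟪ν, z⟫ < 0 := by
            rw [← inner_sub_right, real_inner_comm]; exact hy.2
          have := mul_le_mul_of_nonneg_left h2.le (inv_nonneg.2 hνn.le)
          linarith [mul_sub ‖ν‖⁻¹ ⟪ν, y⟫ ⟪ν, z⟫]
        · have := hc i; rw [abs_lt] at this; linarith
    · have hae : ∀ᵐ y : H ∂volume, y ∉ {y : H | ⟪y - z, ν⟫ = 0} :=
        compl_mem_ae_iff.2 (volume_hyperplane_eq_zero hν z)
      filter_upwards [hae] with y hy hmem
      by_cases hyb : y ∈ ball z R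
      · exfalso
        have h0 : T y 0 ≤ hi 0 := (mem_Icc.1 hmem.1).2 0
        simp only [hhi, if_pos rfl, hT_apply, hb0_inner] at h0
        have h1 : ⟪ν, y⟫ ≤ ⟪ν, z⟫ := le_of_mul_le_mul_left h0 (inv_pos.2 hνn)
        have h2 : ¬ (⟪y - z, ν⟫ < 0) := fun h ↦ hmem.2 (mem_halfBall.2 ⟨hyb, h⟩)
        refine hy ?_
        show ⟪y - z, ν⟫ = 0
        rw [inner_sub_left] at h2 ⊢
        rw [real_inner_comm y ν, real_inner_comm z ν] at h1
        have h2' := not_lt.1 h2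
        linarith
      · exact hdiv_zero y hyb
  -- the right-hand side: only the top face survives
  have hface_zero : ∀ (i : Fin (n + 1)) (t : ℝ), |t - ⟪b i, z⟫| = R →
      ∀ x : Fin n → ℝ, f i (Fin.insertNth i t x) = 0 := fun i t ht x ↦ by
    simp only [hf]
    have hy : Ti (Fin.insertNth i t x) ∉ ball z R := fun h ↦ by
      have := hcoord _ h i
      rw [← hT_apply, hT_Ti, Fin.insertNth_apply_same] at this
      exact this.ne ht
    rw [hXzero _ hy, inner_zero_left]
  have hRHS : ∑ i : Fin (n + 1),
      ((∫ x in Icc (lo ∘ Fin.succAbove i) (hi ∘ Fin.succAbove i), f i (Fin.insertNth i (hi i) x)) -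
        ∫ x in Icc (lo ∘ Fin.succAbove i) (hi ∘ Fin.succAbove i),
          f i (Fin.insertNth i (lo i) x)) =
      ∫ x in Icc (lo ∘ Fin.succAbove 0) (hi ∘ Fin.succAbove 0), f 0 (Fin.insertNth 0 (hi 0) x) := by
    rw [Fin.sum_univ_succ]
    have hback : ∀ i, (fun x : Fin n → ℝ ↦ f i (Fin.insertNth i (lo i) x)) = fun _ ↦ 0 := fun i ↦
      funext fun x ↦ hface_zero i (lo i) (by
        simp only [hlo]; rw [show ⟪b i, z⟫ - R - ⟪b i, z⟫ = -R by ring, abs_neg, abs_of_pos hR]) x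
    have hfront : ∀ i : Fin n,
        (fun x : Fin n → ℝ ↦ f i.succ (Fin.insertNth i.succ (hi i.succ) x)) = fun _ ↦ 0 := fun i ↦
      funext fun x ↦ hface_zero i.succ (hi i.succ) (by
        simp only [hhi, if_neg (Fin.succ_ne_zero i)]
        rw [show ⟪b i.succ, z⟫ + R - ⟪b i.succ, z⟫ = R by ring, abs_of_pos hR]) x
    simp only [hback, hfront, integral_zero, sub_zero, Finset.sum_const_zero, add_zero]
  rw [← hLHS, key, hRHS]
  simp only [hf, hhi, if_pos rfl, hTi]

/-- **`∫ div X = 0`** for a `C¹` field supported in a ball (a half-ball containing the support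
strictly below its flat face). [folklore] -/
theorem integral_divergence_eq_zero_of_tsupport_subset_ball
    (b : OrthonormalBasis (Fin (n + 1)) ℝ H) {z : H} {R : ℝ} (hR : 0 < R) {X : H → H}
    (hX : ContDiff ℝ 1 X) (hXs : tsupport X ⊆ ball z R) :
    ∫ y, ∑ i, ⟪fderiv ℝ X y (b i), b i⟫ = 0 := by
  have hb1 : ‖b 0‖ = 1 := b.orthonormal.1 0
  have hb0 : b 0 ≠ 0 := fun h ↦ by rw [h, norm_zero] at hb1; exact zero_ne_one hb1
  set z' : H := z + (2 * R) • b 0 with hz'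
  have hball : ball z R ⊆ ball z' (4 * R) := fun y hy ↦ by
    rw [mem_ball] at hy ⊢
    have hzz' : dist z z' = 2 * R := by
      rw [hz', dist_eq_norm, sub_add_cancel_left, norm_neg, norm_smul, hb1, mul_one,
        Real.norm_eq_abs, abs_of_pos (by positivity)]
    calc dist y z' ≤ dist y z + dist z z' := dist_triangle _ _ _
      _ < R + 2 * R := by rw [hzz']; linarith
      _ ≤ 4 * R := by linarith
  have hinner : ∀ y ∈ ball z R, ⟪y - z', b 0⟫ < -R := fun y hy ↦ by
    have h1 : |⟪y - z, b 0⟫| ≤ ‖y - z‖ := by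
      have := abs_real_inner_le_norm (y - z) (b 0); rwa [hb1, mul_one] at this
    rw [hz', show y - (z + (2 * R) • b 0) = (y - z) - (2 * R) • b 0 by abel, inner_sub_left,
      real_inner_smul_left, real_inner_self_eq_norm_sq, hb1]
    rw [mem_ball, dist_eq_norm] at hy
    have := (abs_le.1 h1).2
    nlinarith
  have hhalf : ball z R ⊆ (halfBall (b 0) z' (4 * R) : Set H) := fun y hy ↦
    mem_halfBall.2 ⟨hball hy, by linarith [hinner y hy, hR]⟩
  have hD := setIntegral_divergence_halfBall b hb0 (by rw [hb1, inv_one, one_smul])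
    (by positivity) hX (hXs.trans hball)
  -- the face integrand vanishes
  have hface : (fun x : Fin n → ℝ ↦ ⟪X (b.repr.symm (WithLp.toLp 2
      (Fin.insertNth (0 : Fin (n + 1)) ⟪b 0, z'⟫ x))), b 0⟫) = fun _ ↦ 0 := by
    funext x
    set y : H := b.repr.symm (WithLp.toLp 2 (Fin.insertNth (0 : Fin (n + 1)) ⟪b 0, z'⟫ x))
    have hy0 : ⟪b 0, y⟫ = ⟪b 0, z'⟫ := by
      have : b.repr y 0 = ⟪b 0, z'⟫ := by
        simp only [y, LinearIsometryEquiv.apply_symm_apply]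
        exact Fin.insertNth_apply_same _ _ _
      rw [← this, OrthonormalBasis.repr_apply_apply]
    have hyb : y ∉ ball z R := fun h ↦ by
      have := hinner y h
      rw [inner_sub_left, real_inner_comm, hy0, real_inner_comm, sub_self] at this
      linarith
    rw [image_eq_zero_of_notMem_tsupport fun h ↦ hyb (hXs h), inner_zero_left]
  rw [hface, integral_zero] at hD
  rw [← hD]
  symm
  refine setIntegral_eq_integral_of_forall_compl_eq_zero fun y hy ↦ ?_
  have hyb : y ∉ ball z R := fun h ↦ hy (hhalf h)
  have : fderiv ℝ X y = 0 :=
    image_eq_zero_of_notMem_tsupport fun h ↦ hyb (hXs (tsupport_fderiv_subset ℝ h))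
  simp [this]

omit [FiniteDimensional ℝ H] [MeasurableSpace H] [BorelSpace H] in
/-- Product rule for the divergence: `div (g Y) = ∂g(Y) + g div Y`. [folklore] -/
theorem sum_inner_fderiv_smul (b : OrthonormalBasis (Fin (n + 1)) ℝ H) {g : H → ℝ} {Y : H → H}
    {y : H} (hg : DifferentiableAt ℝ g y) (hY : DifferentiableAt ℝ Y y) :
    ∑ i, ⟪fderiv ℝ (fun x ↦ g x • Y x) y (b i), b i⟫ =
      fderiv ℝ g y (Y y) + g y * ∑ i, ⟪fderiv ℝ Y y (b i), b i⟫ := by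
  rw [fderiv_fun_smul hg hY]
  simp only [_root_.add_apply, FunLike.coe_smul, Pi.smul_apply,
    ContinuousLinearMap.smulRight_apply, inner_add_left, real_inner_smul_left,
    Finset.sum_add_distrib,
    Finset.mul_sum]
  rw [add_comm]
  congr 1
  calc ∑ i, fderiv ℝ g y (b i) * ⟪Y y, b i⟫
      = fderiv ℝ g y (∑ i, ⟪b i, Y y⟫ • b i) := by
        rw [map_sum]
        refine Finset.sum_congr rfl fun i _ ↦ ?_
        rw [map_smul, smul_eq_mul, real_inner_comm, mul_comm]
    _ = fderiv ℝ g y (Y y) := by rw [b.sum_repr']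

omit [InnerProductSpace ℝ H] [FiniteDimensional ℝ H] [MeasurableSpace H] [BorelSpace H] in
/-- A function continuous on an open set times a continuous function supported inside the set is
continuous. [folklore] -/
theorem continuous_mul_of_tsupport_subset {U : Set H} (hU : IsOpen U) {F g : H → ℝ}
    (hF : ContinuousOn F U) (hg : Continuous g) (hgU : tsupport g ⊆ U) :
    Continuous fun y ↦ F y * g y := by
  refine continuous_iff_continuousAt.2 fun y ↦ ?_
  by_cases hy : y ∈ U
  · exact (hF.continuousAt (hU.mem_nhds hy)).mul hg.continuousAt
  · have hy' : y ∉ tsupport g := fun h ↦ hy (hgU h)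
    have hev : g =ᶠ[𝓝 y] 0 := notMem_tsupport_iff_eventuallyEq.1 hy'
    have hev' : (fun x ↦ F x * g x) =ᶠ[𝓝 y] fun _ ↦ 0 := by
      filter_upwards [hev] with x hx
      rw [hx, Pi.zero_apply, mul_zero]
    exact (continuousAt_const (y := (0 : ℝ))).congr_of_eventuallyEq hev'

/-- **The equation holds pointwise** for a `C¹` flux with continuous source: if
`∫_U ∂ζ(Y) = ∫_U F ζ` for all `ζ ∈ C_c^∞(U)`, then `div Y = -F` on `U`. [folklore] -/
theorem divergence_eq_neg_of_weak (b : OrthonormalBasis (Fin (n + 1)) ℝ H) {U : Set H}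
    (hU : IsOpen U) {Y : H → H} (hY : ContDiff ℝ 1 Y) {F : H → ℝ} (hF : ContinuousOn F U)
    (hweak : ∀ ζ : H → ℝ, ContDiff ℝ ∞ ζ → HasCompactSupport ζ → tsupport ζ ⊆ U →
      ∫ y in U, fderiv ℝ ζ y (Y y) = ∫ y in U, F y * ζ y) :
    ∀ y ∈ U, ∑ i, ⟪fderiv ℝ Y y (b i), b i⟫ = -F y := by
  set D : H → ℝ := fun y ↦ ∑ i, ⟪fderiv ℝ Y y (b i), b i⟫ with hD
  have hDc : Continuous D := continuous_finsetSum _ fun i _ ↦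
    (((hY.continuous_fderiv one_ne_zero).clm_apply continuous_const).inner continuous_const)
  have hUm : MeasurableSet U := hU.measurableSet
  -- `D + F = 0` a.e. on `U`
  have hae : ∀ᵐ y ∂volume, y ∈ U → (D y + F y) = 0 := by
    refine hU.ae_eq_zero_of_integral_contDiff_smul_eq_zero
      ((hDc.continuousOn.add hF).locallyIntegrableOn hUm) fun g hg hgc hgU ↦ ?_
    obtain ⟨R, hR, hgR⟩ : ∃ R, 0 < R ∧ tsupport g ⊆ ball (0 : H) R := by
      obtain ⟨R, hR⟩ := hgc.isCompact.isBounded.subset_ball_lt 0 0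
      exact ⟨R, hR.1, hR.2⟩
    -- `∫ div (g Y) = 0`
    have hX : ContDiff ℝ 1 fun x ↦ g x • Y x := (hg.of_le (by exact_mod_cast le_top)).smul hY
    have h0 := integral_divergence_eq_zero_of_tsupport_subset_ball b hR hX
      ((tsupport_smul_subset_left _ _).trans hgR)
    have hprod : ∀ y, ∑ i, ⟪fderiv ℝ (fun x ↦ g x • Y x) y (b i), b i⟫ =
        fderiv ℝ g y (Y y) + g y * D y := fun y ↦
      sum_inner_fderiv_smul b (hg.differentiable (by simp) y) (hY.differentiable one_ne_zero y)
    simp_rw [hprod] at h0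
    -- both summands are integrable (continuous, compactly supported)
    have hg1 : Continuous fun y ↦ fderiv ℝ g y (Y y) :=
      (hg.continuous_fderiv (by simp)).clm_apply hY.continuous
    have hg1s : HasCompactSupport fun y ↦ fderiv ℝ g y (Y y) := by
      refine (hgc.fderiv (𝕜 := ℝ)).mono fun y hy ↦ ?_
      intro h; apply hy
      show fderiv ℝ g y (Y y) = 0
      rw [h]; rfl
    have hg2 : Continuous fun y ↦ g y * D y := hg.continuous.mul hDc
    have hg2s : HasCompactSupport fun y ↦ g y * D y := hgc.mul_right
    have hi1 : Integrable (fun y ↦ fderiv ℝ g y (Y y)) volume :=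
      hg1.integrable_of_hasCompactSupport hg1s
    have hi2 : Integrable (fun y ↦ g y * D y) volume := hg2.integrable_of_hasCompactSupport hg2s
    rw [integral_add hi1 hi2] at h0
    -- reduce the integrals to `U`
    have hgzero : ∀ y, y ∉ U → g y = 0 := fun y hy ↦
      image_eq_zero_of_notMem_tsupport fun h ↦ hy (hgU h)
    have hdgzero : ∀ y, y ∉ U → fderiv ℝ g y = 0 := fun y hy ↦
      image_eq_zero_of_notMem_tsupport fun h ↦ hy (hgU (tsupport_fderiv_subset ℝ h))
    have e1 : ∫ y, fderiv ℝ g y (Y y) = ∫ y in U, fderiv ℝ g y (Y y) :=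
      (setIntegral_eq_integral_of_forall_compl_eq_zero fun y hy ↦ by
        rw [hdgzero y hy]; rfl).symm
    have e2 : ∫ y, g y * D y = ∫ y in U, g y * D y :=
      (setIntegral_eq_integral_of_forall_compl_eq_zero fun y hy ↦ by
        rw [hgzero y hy, zero_mul]).symm
    have e3 : ∫ y, g y • (D y + F y) = ∫ y in U, g y • (D y + F y) :=
      (setIntegral_eq_integral_of_forall_compl_eq_zero fun y hy ↦ by
        rw [hgzero y hy, zero_smul]).symm
    rw [e1, e2, hweak g hg hgc hgU] at h0
    rw [e3]
    -- `F g` is integrable on `U`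
    have hFg : Continuous fun y ↦ F y * g y :=
      continuous_mul_of_tsupport_subset hU hF hg.continuous hgU
    have hiFg : IntegrableOn (fun y ↦ F y * g y) U :=
      (hFg.integrable_of_hasCompactSupport hgc.mul_left).integrableOn
    have hsplit : ∫ y in U, g y • (D y + F y) = (∫ y in U, g y * D y) + ∫ y in U, F y * g y := by
      rw [← integral_add hi2.integrableOn hiFg]
      refine integral_congr_ae (Eventually.of_forall fun y ↦ ?_)
      simp only [smul_eq_mul]; ring
    rw [hsplit]; linarith
  -- continuity upgrades a.e. to everywhere
  have hae' : (fun y ↦ D y + F y) =ᵐ[volume.restrict U] fun _ ↦ (0 : ℝ) :=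
    (ae_restrict_iff' hUm).2 hae
  have heq := Measure.eqOn_open_of_ae_eq hae' hU (hDc.continuousOn.add hF) continuousOn_const
  intro y hy
  have := heq hy
  simp only at this
  show D y = -F y
  linarith

/-- **The conormal boundary condition holds pointwise** (Evans, *PDE*, §6.3.2; Taylor, *PDE I*,
Ch. 5 §7, (7.13)–(7.14): a sufficiently regular weak solution of the Neumann problem satisfies the
boundary condition): if `Y ∈ C¹`, `F` is continuous on `B(z,R)` and
`∫_{U_R} ∂ζ(Y) = ∫_{U_R} F ζ` for all `ζ ∈ C_c^∞(B(z,R))`, then `⟪Y, ν⟫ = 0` on the flat part of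
`∂U_R`. [cite: TaylorPDEI2011, Ch. 5 §7, (7.13)–(7.14)] -/
theorem inner_eq_zero_of_weak_halfBall (hn : Module.finrank ℝ H = n + 1) {ν z : H} (hν : ν ≠ 0)
    {R : ℝ} (hR : 0 < R) {Y : H → H}
    (hY : ContDiff ℝ 1 Y) {F : H → ℝ} (hF : ContinuousOn F (ball z R))
    (hweak : ∀ ζ : H → ℝ, ContDiff ℝ ∞ ζ → HasCompactSupport ζ → tsupport ζ ⊆ ball z R →
      ∫ y in (halfBall ν z R : Set H), fderiv ℝ ζ y (Y y) =
        ∫ y in (halfBall ν z R : Set H), F y * ζ y)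
    {y₀ : H} (hy₀ : y₀ ∈ ball z R) (hflat : ⟪y₀ - z, ν⟫ = 0) : ⟪Y y₀, ν⟫ = 0 := by
  -- an orthonormal basis with `b 0 = ν/‖ν‖`
  have hνn : 0 < ‖ν‖ := norm_pos_iff.2 hν
  set ν₁ : H := ‖ν‖⁻¹ • ν with hν₁
  have hν₁n : ‖ν₁‖ = 1 := by
    rw [hν₁, norm_smul, norm_inv, norm_norm, inv_mul_cancel₀ hνn.ne']
  obtain ⟨b, hb⟩ : ∃ b : OrthonormalBasis (Fin (n + 1)) ℝ H, b 0 = ν₁ := by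
    have hon : Orthonormal ℝ (({0} : Set (Fin (n + 1))).restrict fun _ : Fin (n + 1) ↦ ν₁) := by
      classical
      rw [orthonormal_iff_ite]
      intro i j
      rw [Subsingleton.elim j i, if_pos rfl]
      simp only [restrict_apply, real_inner_self_eq_norm_sq, hν₁n, one_pow]
    obtain ⟨b, hb⟩ := hon.exists_orthonormalBasis_extension_of_card_eq
      (by rw [hn, Fintype.card_fin])
    exact ⟨b, hb 0 rfl⟩
  -- the equation in the interior
  set U : Set H := (halfBall ν z R : Set H) with hU
  have hUo : IsOpen U := (halfBall ν z R).isOpen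
  have hUm : MeasurableSet U := hUo.measurableSet
  have hPDE := divergence_eq_neg_of_weak b hUo hY (hF.mono halfBall_subset_ball)
    (fun ζ hζ hζc hζU ↦ hweak ζ hζ hζc (hζU.trans halfBall_subset_ball))
  set D : H → ℝ := fun y ↦ ∑ i, ⟪fderiv ℝ Y y (b i), b i⟫ with hD
  have hDc : Continuous D := continuous_finsetSum _ fun i _ ↦
    (((hY.continuous_fderiv one_ne_zero).clm_apply continuous_const).inner continuous_const)
  -- suppose not
  by_contra hk
  set k₀ : ℝ := ⟪Y y₀, ν⟫ with hk₀
  have hkc : Continuous fun y ↦ k₀ * ⟪Y y, ν⟫ :=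
    continuous_const.mul (hY.continuous.inner continuous_const)
  have hpos₀ : 0 < k₀ * ⟪Y y₀, ν⟫ := by rw [← hk₀]; exact mul_self_pos.2 hk
  obtain ⟨δ, hδ, hδball, hδpos⟩ :
      ∃ δ > 0, ball y₀ δ ⊆ ball z R ∧ ∀ y ∈ ball y₀ δ, 0 < k₀ * ⟪Y y, ν⟫ := by
    have h1 : ∀ᶠ y in 𝓝 y₀, 0 < k₀ * ⟪Y y, ν⟫ := hkc.continuousAt.eventually (lt_mem_nhds hpos₀)
    have h2 : ∀ᶠ y in 𝓝 y₀, y ∈ ball z R := isOpen_ball.mem_nhds hy₀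
    obtain ⟨δ, hδ, hδ'⟩ := Metric.eventually_nhds_iff_ball.1 (h1.and h2)
    exact ⟨δ, hδ, fun y hy ↦ (hδ' y hy).2, fun y hy ↦ (hδ' y hy).1⟩
  -- the test field `X = θ Y`
  let θ : ContDiffBump y₀ := ⟨δ / 4, δ / 2, by positivity, by linarith⟩
  have hθs : tsupport (θ : H → ℝ) ⊆ ball y₀ δ := by
    rw [θ.tsupport_eq]; exact closedBall_subset_ball (by show δ / 2 < δ; linarith)
  set X : H → H := fun y ↦ θ y • Y y with hX
  have hXC : ContDiff ℝ 1 X := (θ.contDiff (n := 1)).smul hY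
  have hXs : tsupport X ⊆ ball z R := ((tsupport_smul_subset_left _ _).trans hθs).trans hδball
  have hdiv := setIntegral_divergence_halfBall b hν hb hR hXC hXs
  -- the left-hand side vanishes
  have hprod : ∀ y, ∑ i, ⟪fderiv ℝ X y (b i), b i⟫ = fderiv ℝ θ y (Y y) + θ y * D y := fun y ↦
    sum_inner_fderiv_smul b ((θ.contDiff (n := 1)).differentiable one_ne_zero y)
      (hY.differentiable one_ne_zero y)
  have hθF : Continuous fun y ↦ F y * θ y :=
    continuous_mul_of_tsupport_subset isOpen_ball hF θ.continuous (hθs.trans hδball)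
  have hiθF : IntegrableOn (fun y ↦ F y * θ y) U :=
    (hθF.integrable_of_hasCompactSupport θ.hasCompactSupport.mul_left).integrableOn
  have hi1 : IntegrableOn (fun y ↦ fderiv ℝ θ y (Y y)) U := by
    refine (Continuous.integrable_of_hasCompactSupport ?_ ?_).integrableOn
    · exact ((θ.contDiff (n := 1)).continuous_fderiv one_ne_zero).clm_apply hY.continuous
    · refine (θ.hasCompactSupport.fderiv (𝕜 := ℝ)).mono fun y hy ↦ ?_
      intro h; apply hy
      show fderiv ℝ (θ : H → ℝ) y (Y y) = 0
      rw [h]; rfl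
  have hLHS : ∫ y in U, ∑ i, ⟪fderiv ℝ X y (b i), b i⟫ = 0 := by
    simp_rw [hprod]
    have e2 : ∫ y in U, θ y * D y = -∫ y in U, F y * θ y := by
      rw [← integral_neg]
      refine setIntegral_congr_fun hUm fun y hy ↦ ?_
      rw [show D y = -F y from hPDE y hy]; ring
    have hi2 : IntegrableOn (fun y ↦ θ y * D y) U := by
      have : (fun y ↦ θ y * D y) =ᵐ[volume.restrict U] fun y ↦ -(F y * θ y) :=
        ae_restrict_of_forall_mem hUm fun y hy ↦ by
          show θ y * D y = -(F y * θ y)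
          rw [show D y = -F y from hPDE y hy]; ring
      exact (hiθF.neg).congr this.symm
    rw [integral_add hi1 hi2, e2, hweak θ θ.contDiff θ.hasCompactSupport (hθs.trans hδball)]
    ring
  -- the right-hand side is positive after multiplication by `k₀`
  set lo : Fin (n + 1) → ℝ := fun i ↦ ⟪b i, z⟫ - R with hlo
  set hi : Fin (n + 1) → ℝ := fun i ↦ if i = 0 then ⟪b 0, z⟫ else ⟪b i, z⟫ + R with hhi
  set q : (Fin n → ℝ) → H := fun x ↦
    b.repr.symm (WithLp.toLp 2 (Fin.insertNth (0 : Fin (n + 1)) ⟪b 0, z⟫ x)) with hq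
  set G : (Fin n → ℝ) → ℝ := fun x ↦ ⟪X (q x), b 0⟫ with hG
  have hRHS : ∫ x in Icc (lo ∘ Fin.succAbove 0) (hi ∘ Fin.succAbove 0), G x = 0 := by
    rw [← hLHS, hdiv]
  -- continuity of `q` and `G`
  have hqc : Continuous q :=
    b.repr.symm.continuous.comp ((PiLp.continuous_toLp 2 _).comp
      (Continuous.finInsertNth (0 : Fin (n + 1)) continuous_const continuous_id))
  have hGc : Continuous G := (hXC.continuous.comp hqc).inner continuous_const
  -- `k₀ G ≥ 0`
  have hGval : ∀ x, G x = ‖ν‖⁻¹ * (θ (q x) * ⟪Y (q x), ν⟫) := fun x ↦ by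
    simp only [hG, hX, hb, hν₁, real_inner_smul_left, real_inner_smul_right, real_inner_comm]
    ring
  have hnn : ∀ x, 0 ≤ k₀ * G x := fun x ↦ by
    rw [hGval, show k₀ * (‖ν‖⁻¹ * (θ (q x) * ⟪Y (q x), ν⟫)) =
      ‖ν‖⁻¹ * θ (q x) * (k₀ * ⟪Y (q x), ν⟫) by ring]
    by_cases hθ0 : θ (q x) = 0
    · rw [hθ0]; simp
    · have hmem : q x ∈ ball y₀ δ := by
        have : q x ∈ support (θ : H → ℝ) := hθ0
        rw [θ.support_eq] at this
        exact ball_subset_ball (by show δ / 2 ≤ δ; linarith) this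
      exact mul_nonneg (mul_nonneg (inv_nonneg.2 hνn.le) θ.nonneg) (hδpos _ hmem).le
  -- the base point of the face under `y₀`
  set x₀ : Fin n → ℝ := fun j ↦ ⟪b (Fin.succAbove 0 j), y₀⟫ with hx₀
  have hb0y : ⟪b 0, y₀⟫ = ⟪b 0, z⟫ := by
    rw [hb, hν₁, real_inner_smul_left, real_inner_smul_left, ← sub_eq_zero, ← mul_sub,
      ← inner_sub_right, real_inner_comm, hflat, mul_zero]
  have hqx₀ : q x₀ = y₀ := by
    have : Fin.insertNth (0 : Fin (n + 1)) ⟪b 0, z⟫ x₀ = WithLp.ofLp (b.repr y₀) := by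
      rw [← hb0y]
      funext i
      refine Fin.cases ?_ (fun j ↦ ?_) i
      · rw [Fin.insertNth_apply_same]
        simp [OrthonormalBasis.repr_apply_apply]
      · rw [show (j.succ : Fin (n + 1)) = Fin.succAbove 0 j from rfl, Fin.insertNth_apply_succAbove]
        simp [hx₀, OrthonormalBasis.repr_apply_apply]
    rw [hq]; show b.repr.symm (WithLp.toLp 2 (Fin.insertNth (0 : Fin (n + 1)) ⟪b 0, z⟫ x₀)) = y₀
    rw [this]; simp
  have hGx₀ : 0 < k₀ * G x₀ := by
    rw [hGval, hqx₀, θ.one_of_mem_closedBall (mem_closedBall_self (by positivity)), one_mul,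
      show k₀ * (‖ν‖⁻¹ * ⟪Y y₀, ν⟫) = ‖ν‖⁻¹ * (k₀ * ⟪Y y₀, ν⟫) by ring]
    exact mul_pos (inv_pos.2 hνn) hpos₀
  -- `x₀` is an interior point of the face box
  have hcoord : ∀ i, |⟪b i, y₀⟫ - ⟪b i, z⟫| < R := fun i ↦ by
    rw [← inner_sub_right]
    refine lt_of_le_of_lt (abs_real_inner_le_norm _ _) ?_
    rw [b.orthonormal.1 i, one_mul, ← dist_eq_norm]; exact hy₀
  have hnhds : Icc (lo ∘ Fin.succAbove 0) (hi ∘ Fin.succAbove 0) ∈ 𝓝 x₀ := by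
    refine pi_Icc_mem_nhds (fun j ↦ ?_) (fun j ↦ ?_)
    · simp only [comp_apply, hlo, hx₀]
      have := hcoord (Fin.succAbove 0 j); rw [abs_lt] at this; linarith
    · simp only [comp_apply, hhi, hx₀, if_neg (Fin.succAbove_ne 0 j)]
      have := hcoord (Fin.succAbove 0 j); rw [abs_lt] at this; linarith
  have hposI : 0 < ∫ x in Icc (lo ∘ Fin.succAbove 0) (hi ∘ Fin.succAbove 0), k₀ * G x := by
    have hci : Continuous fun x ↦ k₀ * G x := continuous_const.mul hGc
    rw [setIntegral_pos_iff_support_of_nonneg_ae (Eventually.of_forall fun x ↦ hnn x)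
      (hci.continuousOn.integrableOn_compact isCompact_Icc)]
    exact Measure.measure_pos_of_mem_nhds (x := x₀) volume (inter_mem
      (hci.continuousAt.preimage_mem_nhds (isOpen_ne.mem_nhds hGx₀.ne')) hnhds)
  rw [integral_const_mul, hRHS, mul_zero] at hposI
  exact lt_irrefl _ hposI

end Literature.Analysis.PDE

end
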